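import Mathlib
import HarnessLib
import Summits.QuantumAdvantage.QuantumAdvantage.Theorems.XorDialA
import Summits.QuantumAdvantage.AdviceFreeQNC0.AdviceFreeQNC0Odd

/-!
# XorDial, part B/3 (§2 the ASSEMBLY `walkHardF_of_law` / `walkHardF_of_capLaw` (Q + law ⇒ constant hardness, `log_transfer`), `quasiLoss_of_target`, and the Theses-free node corollaries (§N′)) — support for item stmt-QuantumAdvantage-26994 (`Theses.FeatureShadow.Target`)

Cell decomp-qadv, seat lens-1 («grading / quantitative ladder»), generation 18 — land port of the node «XorDial» (published under the cell's HOME/decomp-qadv-lens-1/g18/XorDial.lean, record NODE-g18.md, critic row 72v34 VERIFIED-as-LAW; RESIDUAL MODE on AbsorptionDial:26763 / FeatureShadow:26994 / OddPrimeWalk:23109).  The node file with ONLY the namespace renamed `Theses.XorDial → Theorems.XorDial` and split at section boundaries into parts A–C (B imports A; C is independent; NO part imports a route file — the BY-NAME `closes*` stay in the HOME node).  Prop-defs = the node's hardness cells and laws only (`Exc`, `XorLaw`, `CapLaw`, `XorLawCap`, `XorLawOdd`, `XorLawCapOdd`, part A).  Tree facts reused by name, not restated: `LengthDial.HardR/hardR_mono/winCount_le/QuasiLoss/WalkHardF`-side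 lemmas (LengthDialB/C), `adviceFreeQNC0Odd_of_walkHardF`, `wt`, `wtPrefix`, `walkExp`, `ringWinU` (WalkTransport / Elimination).  No `sorry`, no new axioms, no instances, no notation.

PART B CONTENT: the assembly from the Q grade under the law, the necessity `quasiLoss_of_target` (T ⇒ Q), and the node equations in leaf / unfolded-Target form.

NODE SYNOPSIS (all parts):

# XorDial — the θ-AXIS of the odd-prime u-walk rung: a CONCATENATION (XOR) LAW for the game's excess, which PRICES the
loss-grade ladder X < Floor < Q < T and pays exactly the edge the cell's routes leave residual

Cell decomp-qadv, seat lens-1 («grading / quantitative ladder»), generation 18 (+ REV 1: capped law, exact `V₁(8)`).  RESIDUAL MODE.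
Concluded BY NAME (load-bearing law piece = the CAPPED law `XorLawCapOdd`; the sharp law `XorLawOdd` implies it, `xorLawCapOdd_of_xorLawOdd`):
* `closes : XorLawCapOdd → Q → AbsorptionDial.DerandLiftOdd` — the registered residual stmt-QuantumAdvantage-26763
  (`DetSepOdd → AdviceFreeQNC0Odd`, RESIDUAL · NO-SHRINK · BARRIER «no Adleman for FAC⁰[p]») is DISCHARGED under the law
  (the leaf follows from the route's own Q grade on the walk side, so the circuit-side derandomisation is bypassed);
* `closes_T : XorLawCapOdd → Q → FeatureShadow.Target` — the odd Target 26994 `∀ p ≥ 5, WalkHardF p`, value `θ = (2 + max κ ¼)/3`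
  (`closes_T_sharp`: `θ = 3/4` from the sharp law);
* `closes_leaf`, and `closes_chain : NoPerfectPolyOdd → MassLoQuarter → MassHiQuasi → XorLawCapOdd → AdviceFreeQNC0Odd`
  (AbsorptionDial's assembly 28402 with its last two items `QuasiLossBridgeOdd`, `DerandLiftOdd` replaced by the law); `closes_sharp`;
* `closes_door : XorLawCapOdd → Q → OddPrimeWalk.ManyReadersSqrtOdd` — BLOCKER stmt-QuantumAdvantage-23109 (T restricted to a class;
  `manyReadersSqrtOdd_of_target` drops the class hypotheses).
Here `Q := LengthDial.QuasiLoss` (tree decl; verbatim the consequent of 28401 `MassHiQuasi` and the antecedent of 28403).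

## THE AXIS (new by construction)
The cell's theorems on this rung are organised along the LOSS GRADE `θ(n)` of the cell `HardR p n D θ` (LengthDialC):
X one loss (28487) < Floor `2^{n^{1/4}}` losses (28488, ⟸ X PROVED) < Q loss fraction `2^{-polylog}` (28401, residual, lens-5)
< T_poly `1/poly` (26767) < T constant `θ` (26994) < TwoThirds `θ = 2/3 + ε` (named conjecture).  The edges Floor→Q and Q→T are
OPEN; AbsorptionDial sidesteps Q→T by leaving the walk (`Q → DetSepOdd`, PROVED, GradeDial) and pays instead the circuit-side
residual 26763.  This node dials the SAME edge on the walk side: Q→T is AMPLIFICATION OF THE EXCESS, and the dial is the behaviour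
of the NORMALISED EXCESS `E_D(n) := 3·max_c V_D(n,c) − 2` (`E = 1` ⟺ some charge is played perfectly, `E = 0` ⟺ value 2/3) under
CONCATENATION of lengths.  Cells: `Exc p n D E := HardR p n D ((2+E)/3)` (§0).

## THE MECHANISM (PROVED, §3): `ringWinU_append`
For `u = u₁ ++ u₂` (`Fin.append`), the win bit of the length-`(n₁+n₂)` game at charge `c` is the XOR of the PREFIX game
(cuts `0..n₁`, strategy `pre y u₂`) at the ENCRYPTED charge `c + |u₂|` and the SUFFIX game (cuts `n₁..n₁+n₂` re-indexed, shared
cut silenced, strategy `suf y u₁`) at the encrypted charge `c + n₁ + 2|u₁|` — exact equalities of naturals `cut_append_left/right`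
(`walkExp (u₁++u₂) g = walkExp u₁ g + |u₂|` for `g ≤ n₁`, `walkExp (u₁++u₂) (n₁+h) = 2|u₁| + walkExp u₂ h`).  Each half's charge
is keyed by the OTHER half's weight mod 3, a key a low-`𝔽_p`-degree player cannot read (Smolensky), and `ChargeTriple` (tree)
caps a bet on one key value at `2/3`: the value `2/3` is the game's zero, whence the normalisation `E = 3V − 2`.

## THE LAW-BET 𝓛 = `XorLaw p` (§0): `E` IS SUBMULTIPLICATIVE IN THE LENGTH AT FIXED DEGREE
`Exc p n₁ D E₁ → Exc p n₂ D E₂ → Exc p (n₁+n₂) D (E₁·E₂)` (`E₁, E₂ ≥ 0`); deficit form `η₁₂ ≥ η₁ + η₂ − 3η₁η₂`.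
EVIDENCE (num/TABLE.md, engine `num/uwalk.c` exhaustive + independent evaluator `num/check.py`):  D = 0 — `E₀(n) = 4^{−⌊(n−1)/2⌋}`
EXACTLY for `n ≤ 16` (confirms and extends lens-5's closed-form conjecture N9b from `n ≤ 11`), and the law holds for all 64 pairs
`n₁ + n₂ ≤ 16`, with EQUALITY iff `n₁, n₂` are both odd and ratio exactly `1/4` otherwise — the blind game SATURATES the law.
D = 1 (class `{0,1,xᵢ,1−xᵢ}` = all `𝔽_p`-degree-1 Boolean cut functions, `p ≥ 3`) — exact `E₁(n) = 1, 1, 1, .8125, .625, .484375,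
.390625` (`n = 1..7`; identical to lens-5's independent table g26/num/deg1_all.txt — two engines agree on every entry); every law
instance with `n₁ + n₂ ≤ 7` is vacuous (a factor has `E = 1`).  FIRST NON-VACUOUS TESTS = the stated test of the UNDECIDED tag:
`max_c V₁(8,c) ≤ 227/256 (.887)`, `V₁(9) ≤ .836`, `V₁(10) ≤ .797`.  ★ K1 RUN (REV 1, this seat, 128 meet-in-the-middle slices
`num/uwalk d1c 8 c k 64`, logs `num/d1_n8_c{0,2}.log`): EXACT `V₁(8,·) = 183, 183, 188 /256` (c = 0, 1, 2; c = 1 from c = 0 by the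
reversal symmetry `V(n,c) = V(n, −c−n mod 3)`), so `E₁(8) = 13/64 = .203 ≤ E₁(4)² = .66` — the first non-vacuous instance HOLDS with
ratio `.31` (and lens-5's LawPiece bound `212/256` holds too); the local-search values at `n = 8` were optimal.  Remaining finite
tests: `V₁(9)` exact (kit lane; LS floor `352/512`, law bound `428/512`), D = 2 at lengths 7..14 (class enumerator of lens-5).
K3 JUNCTION PROBE (REV 2, `num/uprod.c`): at `8 = 4 + 4` the best PRODUCT-FORM degree-1 strategy (prefix cuts read only prefix bits,
suffix cuts only suffix bits) wins `181 / 177` of 256 (c = 0 / 2) against the global `183 / 188`: cross-junction reading is worth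
`+2 / +11`, every global optimum reads across the cut, and both sit far below the law's `227` — independent play at the ENCRYPTED
charges realises `E ≈ .07–.12`, cross-reading `.14–.20`, the law allows `.66`.

## NODE EQUATIONS (0 sorry) and LADDER PRICING (the lens-1 content)
* `walkHardF_of_law : 5 ≤ p → XorLaw p → Q → WalkHardF p` (§2): base `n :=` the largest `m` with `m·2^((log₂ m)^A+2) ≤ N`
  (`Nat.findGreatest`); `exc_iter`/`exc_of_le` (iteration and LENGTH MONOTONICITY from the law), `exc_far` (Bernoulli: a cell of
  excess `1 − 2^{−j}` at length `n` gives value `≤ 3/4` at every `N ≥ n·2^{j+2}`, same degree), `log_transfer` (maximality of `n`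
  keeps `(log₂ N)^{C'} ≤ (log₂ n)^{2(A+1)C'}`).
* PRICING: under 𝓛 the ladder collapses EXACTLY from Q upward.  With `j = (log₂ n)^A` (grade Q) the degree stays polylogarithmic in
  `N` ⟹ T (proved); with `j = n − n^{1/4}` (Floor) or `j = n` (X) the reachable lengths are `N ≥ 2^{n}`, i.e. degree `(log log N)^C`
  only — the law does NOT lift X or Floor to T (growth-rate remark, not typed): 28401 (Floor → Q) is exactly the residual the law
  cannot pay and 26763 the one it pays.  `pieceQ_of_target : Target → Q` (Q is T-implied; `A = 1`, `θ ≤ 1 − 2^{−log₂ n}`).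

## PIECES AND TAGS (target 26763, placed in 26994 / the leaf)
* Q = `LengthDial.QuasiLoss` — [WEAKER than T (`pieceQ_of_target`; the converse IS the amplification edge: probe `Q ⊢ T` fails,
  crux probe vs T and vs 26763 CLEAN) · UNDECIDED · leaf IDEA-NEEDED — it is AbsorptionDial's own open junction (⟸ X ∧ 28488 ∧ 28401),
  NOT a new item; evidence for Q ≢ T: no amplification theorem for polylog-degree strategies is known and Q follows from the floor
  ladder under 28401 while T does not (GradeDial/ScaleDial records)].
* 𝓛_cap = `XorLawCapOdd` (`∀ p ≥ 5, ∃ κ < 1, CapLaw p κ`: `Exc n₁ D E₁ → Exc n₂ D E₂ → Exc (n₁+n₂) D (max κ (E₁E₂))`) — the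
  LOAD-BEARING law piece [UNDECIDED · law-type: NOT T-implied (must-fail `T ⊢ 𝓛_cap`, P12) and ⊬ T (P11), ⊬ Q (P13), Q ⊬ 𝓛_cap (P14),
  not cheaply provable with a trivial cap / refutable (P15/P16), ⊬ the sharp law (P17), ⊬ 26763 (P18); crux probes vs T / vs 26763
  CLEAN · near `E = 1` it coincides with the sharp law (deficits of near-perfect play ADD: `η₁₂ ≥ η₁ + η₂ − 3η₁η₂`), below the cap it
  claims nothing · refutable only by violating families with `E₁E₂ → 1` (test K3) — every finite violation at product value `v`
  still certifies `κ ≥ v` · leaf IDEA-NEEDED (an XOR lemma for cross-keyed halves) / INSTRUMENTABLE through its sharp instances].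
* 𝓛 = `XorLawOdd` (cap `0`) — the ELEGANT STRENGTHENING, not load-bearing [UNDECIDED · implies 𝓛_cap (`xorLawCapOdd_of_xorLawOdd`,
  control 2 of bc/Probe.lean) · rung D = 0 EXACT with EQUALITY at odd+odd (data) · D = 1 first instance PASSED (K1 above) ·
  INSTRUMENTABLE (every finite instance is a finite computation) · caveat: with Q it forces `E_D(N) ≤ E_D(n)^{⌊N/n⌋}` at polylog
  degree — an exponentially small excess, i.e. a correlation bound for log-degree polynomials, BEYOND the catalogued technique
  (see BARRIERS); that overshoot is why the cap is the piece].
HONEST LIMITS. (1) SHARPNESS: the bootstrap from Q needs constant exactly 1 near `E = 1` in either law (deficits must ADD under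
concatenation); any slack `E₁₂ ≤ K·E₁E₂`, `K > 1`, does not bootstrap from a `2^{-polylog}` deficit — constant 1 ATTAINED is what
D = 0 shows.  (2) NO DEGREE LOSS across the cut (degree `D` on both sides) — the feature that separates both laws from LengthDial's
PROVED peel law (degree cost per bit) and makes them bets, squarely inside the question «does concatenation need regularity?».
(3) `closes` consumes only the self-concatenation instances `(k·n, n)` and padding `(N − m, m)` of the law (`excCap_iter`,
`excCap_of_le`), at ONE degree `(log₂ n)^{2(A+1)C'}` per target degree.

## WHY EACH PIECE IS STRICTLY WEAKER / INDEPENDENT; DISTRIBUTED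
Q ⟸ T kernel; T ⟸ Q open (= amplification); 𝓛 independent of T and of Q (probes).  DISTRIBUTED: Q is a COUNTING problem at one
length (absorption / slicing / switching: lens-5, AbsorptionDial, ScaleDial), 𝓛 is a PRODUCT statement across a cut (XOR-lemma /
direct-product technology for low-degree polynomials: Viola–Wigderson «Norms, XOR lemmas, and lower bounds for GF(2) polynomials»
ToC 2008 Thm 1.1–1.2, Bogdanov–Viola FOCS 2007, Smolensky 1987 for the key-unreadability heuristic; none of them is about a game
with cross-encrypted halves — the delta).  Different problems, different tools; neither piece is a parameter value of the other.

## WHY NOVEL (by construction, vs the other five lenses' latest nodes and the cell's product nodes)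
LengthDial / SyndeticDial (lens-5 g26 / g27): LOSSLESS one-bit PEEL law resp. frozen-prefix WINDOW law on the length(-set) axis —
WHICH lengths are hard (i.o. → a.e., syndetic gaps), degree cost per peeled bit, window Floor→Q.  ProductDial / PencilDial (p = 3): direct product ACROSS DISJOINT RINGS (independent instances, joint strategies,
T* = MultiRingHard3).  PumpDial (lens-4 g25): sparsity pumping B_K ⟸ BASE ∧ PUMP.  FrameCertificate / QuarticDial (lens-3):
certificate / class ladders at the root grain.  FieldColumns (lens-6 g18): column restrictions of 32604.  XorDial amplifies WITHIN ONE
INSTANCE along a cut of the SAME ring — the halves are NOT independent (cross-encrypted charges, `ringWinU_append`) — and its law is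
about HOW HARD (the value's excess over 2/3), window Q→T→2/3.  No cell node types an amplification law for the excess; the census
BLOCKERS table (v10) lists «count → fraction → constant» as the untyped content behind 26763 / 26994 / 23109.

## BARRIERS
technique_class: hardness amplification / XOR (concatenation) law for a low-degree polynomial GAME.  NonclassicalDegreeLogBarrier
(polylog-degree regularity constants grow with n): both laws are stated per degree with no loss in D and do not pass through
regularity or switching — honest: that is the bet (D = 0 exact, D = 1 first instance passed).  CORRELATION-BOUNDS BARRIER for
polynomials of degree ≥ log n (Razborov–Smolensky reach error `1/2 − O(d/√n)` only; exponentially small correlation for log-degree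
`𝔽_p`-polynomials is the open problem behind PRGs for AC⁰[p] — Viola–Wigderson ToC 2008 §1, Bogdanov–Viola): T and Q are
CONSTANT- resp. `2^{-polylog}`-error statements and sit on the near side; 𝓛_cap ∧ Q yields only constant error (`θ < 1`), near
side; the SHARP law with Q would put an exponentially small excess at polylog degree on the far side — declared, and the reason the
capped law carries `closes`.  Smolensky/Razborov enter only as the heuristic for the zero `2/3`.
Relativisation / algebrisation (A03-type) barriers do not quantify over this finite game.  Negatives index (`ledger negatives`,
this session): 6 refuted statements (15712, 8592, 2202, 1244, 1615, 9863), none about the u-walk game or products/concatenations of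
it; 𝓛 names no hand-picked constant (typing rule 4c(iv)): its only constants are the game's own `2/3` and the multiplicative unit.

## REPAIR CENSUS (doors tried; detail NODE-g18.md)
value peel on p (g16 ModulusDial: LADDER) · windows of MesoHi3 (g13 RateDial: LAW-LADDER) · restriction splits of 22907 (g15: win-neutral
surgery ⇒ generic ≡ T) · monotone gradings C / pattern / rate / time (g14–g17: top grade ≡ T) · halving-as-RESTRICTION (≡ lens-5's peel
axis; kept only as the mechanism) · direct product across rings (ProductDial's T*, taken) · law + PROVED base only (`degZeroHard`):
the law alone would have to reach T (overshoot / strengthening, PumpDial c2) ⇒ paired with the OPEN weaker Q instead ·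
success-probability grading of 26763 (Adleman's union bound gives the `1 − 2^{−n}` grade for free and every lower grade IS a walk-side
loss grade by averaging ⇒ the circuit dial reduces to this one).

## KILL / DECIDE TESTS
K1 ★ DONE (REV 1): exact `V₁(8,·) = 183, 183, 188 /256` — the sharp law's first non-vacuous instance holds (`13/64 ≤ .66`).  K1′:
`V₁(9)` exact (kit lane; dies iff `> 428/512`; LS floor 352).  K2 D = 2 (`𝔽₅`-degree-2 Boolean = integer-degree-2 class, lens-5
enumerator): first `n` with `E₂(n) < 1` (n ∈ {7, 8}?) then `E₂(2n) ≤ E₂(n)²`.  K3 structural — the ONLY way to refute 𝓛_cap: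
a family of near-perfect concatenations beating the product, i.e. strategies on `u₁ ++ u₂` that read BOTH keys `|u₁|, |u₂| mod 3`
at the junction with vanishing deficit — a refuter's first gadget is a degree-2 «key exchange» across the cut at 4 + 4, then at
growing degree `D ≈ n/2` where each half alone is nearly perfect.

Tree facts reused by name: `LengthDial.HardR / winCount / winCount_le / hardR_mono / QuasiLoss / massHiQuasi_unfold` (LengthDialB/C/G),
`adviceFreeQNC0Odd_of_walkHardF` (AdviceFreeQNC0Odd), `wt`, `wtPrefix`, `walkExp`, `ringWinU` (Elimination / WalkTransport).
No `sorry`, no new axioms, no instances, no notation.  Namespace `Summit.QuantumAdvantage.QuantumAdvantage.Theses.XorDial`.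
-/

set_option autoImplicit false
set_option linter.unusedVariables false
set_option linter.style.longLine false
set_option linter.dupNamespace false

namespace Summit.QuantumAdvantage.QuantumAdvantage.Theorems.XorDial

open Finset
open Summit.QuantumAdvantage.AdviceFreeQNC0
open Summit.QuantumAdvantage.QuantumAdvantage.Theorems.LengthDial

/-! ## §2 From the Q grade to constant hardness under the law (the assembly) -/

section Assembly
variable {p : ℕ} [Fact p.Prime]

/-- the Q grade at prime `p`, exponent `A`, degree exponent `C`, threshold `n₀`, read as a family of cells. -/
theorem exc_of_quasiAt {A C n₀ : ℕ}
    (hQ : ∀ n ≥ n₀, ∀ c : ℕ, ∀ y : Fin (n + 1) → (Fin n → Bool) → Bool,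
      (∀ g, HasDegF p (y g) ((Nat.log 2 n) ^ C)) →
        ((Finset.univ.filter fun u : Fin n → Bool => ringWinU c y u = true).card : ℝ)
          ≤ (1 - 1 / (2 : ℝ) ^ ((Nat.log 2 n) ^ A)) * (2 : ℝ) ^ n)
    {n : ℕ} (hn : n₀ ≤ n) : Exc p n ((Nat.log 2 n) ^ C) (1 - 1 / (2 : ℝ) ^ ((Nat.log 2 n) ^ A)) := by
  intro c y hy
  have h := hQ n hn c y hy
  have hw : (winCount n c y : ℝ)
      = ((Finset.univ.filter fun u : Fin n → Bool => ringWinU c y u = true).card : ℝ) := rfl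
  rw [hw]
  refine h.trans ?_
  apply mul_le_mul_of_nonneg_right _ (by positivity)
  have : 0 ≤ 1 / (2 : ℝ) ^ ((Nat.log 2 n) ^ A) := by positivity
  linarith

/-- elementary: `(L+1) + (L+1)^A + 2 ≤ (L+4)^(A+1)`. -/
theorem aux_pow_bound (L A : ℕ) : (L + 1) + (L + 1) ^ A + 2 ≤ (L + 4) ^ (A + 1) := by
  have h1 : 1 ≤ (L + 1) ^ A := Nat.one_le_pow _ _ (by omega)
  have h2 : (L + 1) ^ A ≤ (L + 4) ^ A := Nat.pow_le_pow_left (by omega) A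
  rw [pow_succ]
  nlinarith [h1, h2]

/-- DEGREE TRANSFER: if `N < (n+1)·2^((log₂(n+1))^A + 2)` and `log₂ n ≥ 3` then `(log₂ N)^C' ≤ (log₂ n)^(2(A+1)C')`. -/
theorem log_transfer {A n N : ℕ} (hn : 3 ≤ Nat.log 2 n)
    (hN : N < (n + 1) * 2 ^ ((Nat.log 2 (n + 1)) ^ A + 2)) (C' : ℕ) :
    (Nat.log 2 N) ^ C' ≤ (Nat.log 2 n) ^ (2 * (A + 1) * C') := by
  set L := Nat.log 2 n with hL
  have hn1 : 1 ≤ n := by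
    rcases Nat.eq_zero_or_pos n with h0 | hpos
    · exfalso; rw [h0] at hL; simp [hL] at hn
    · exact hpos
  have hℓ : Nat.log 2 (n + 1) ≤ L + 1 := by
    have : n + 1 ≤ n * 2 := by omega
    calc Nat.log 2 (n + 1) ≤ Nat.log 2 (n * 2) := Nat.log_mono_right this
      _ = L + 1 := by rw [Nat.log_mul_base (by norm_num) (by omega)]
  have hn2 : n + 1 ≤ 2 ^ (L + 1) := Nat.lt_pow_succ_log_self (by norm_num) n
  have hpowA : (Nat.log 2 (n + 1)) ^ A ≤ (L + 1) ^ A := Nat.pow_le_pow_left hℓ A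
  have hN' : N < 2 ^ ((L + 1) + ((L + 1) ^ A + 2)) := by
    calc N < (n + 1) * 2 ^ ((Nat.log 2 (n + 1)) ^ A + 2) := hN
      _ ≤ 2 ^ (L + 1) * 2 ^ ((L + 1) ^ A + 2) := by
          apply Nat.mul_le_mul hn2
          exact Nat.pow_le_pow_right (by norm_num) (by omega)
      _ = 2 ^ ((L + 1) + ((L + 1) ^ A + 2)) := by rw [← pow_add]
  have hlogN : Nat.log 2 N ≤ (L + 1) + (L + 1) ^ A + 2 := by
    rcases Nat.eq_zero_or_pos N with h0 | hpos
    · rw [h0]; simp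
    · have := (Nat.log_lt_iff_lt_pow (b := 2) (by norm_num) hpos.ne').2 hN'
      omega
  have hM : Nat.log 2 N ≤ (L + 4) ^ (A + 1) := hlogN.trans (aux_pow_bound L A)
  have hsq : L + 4 ≤ L ^ 2 := by nlinarith
  have hM' : Nat.log 2 N ≤ L ^ (2 * (A + 1)) := by
    calc Nat.log 2 N ≤ (L + 4) ^ (A + 1) := hM
      _ ≤ (L ^ 2) ^ (A + 1) := Nat.pow_le_pow_left hsq _
      _ = L ^ (2 * (A + 1)) := by rw [← pow_mul]
  calc (Nat.log 2 N) ^ C' ≤ (L ^ (2 * (A + 1))) ^ C' := Nat.pow_le_pow_left hM' _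
    _ = L ^ (2 * (A + 1) * C') := by rw [← pow_mul]

/-- **THE ASSEMBLY AT ONE PRIME**: the XOR law turns the Q grade (ONE quasi-polynomial loss exponent for every polylog cut-degree)
into CONSTANT hardness `θ = 3/4` — `XorLaw p → Q → WalkHardF p`.  Base length `n :=` the largest `m` with
`m·2^((log₂ m)^A+2) ≤ N` (`Nat.findGreatest`); the law amplifies the deficit `2^{-(log₂ n)^A}` over `2^((log₂ n)^A+2)` blocks
(`exc_far`, Bernoulli), and maximality of `n` keeps the degree polylogarithmic (`log_transfer`). -/
theorem walkHardF_of_law (hp : 5 ≤ p) (hL : XorLaw p) (hQ : QuasiLoss) : WalkHardF p := by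
  obtain ⟨A, hA⟩ := hQ p hp
  refine ⟨3 / 4, by norm_num, fun C' => ?_⟩
  obtain ⟨n₀, hn₀⟩ := hA (2 * (A + 1) * C')
  refine ⟨(max n₀ 8) * 2 ^ ((Nat.log 2 (max n₀ 8)) ^ A + 2), fun N hN c y hy => ?_⟩
  set b : ℕ := max n₀ 8 with hb
  let P : ℕ → Prop := fun m => m * 2 ^ ((Nat.log 2 m) ^ A + 2) ≤ N
  have hPb : P b := hN
  have hbpos : 0 < 2 ^ ((Nat.log 2 b) ^ A + 2) := by positivity
  have hbN : b ≤ N := le_trans (Nat.le_mul_of_pos_right _ hbpos) hN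
  have hPn : P (Nat.findGreatest P N) := Nat.findGreatest_spec hbN hPb
  have hbn : b ≤ Nat.findGreatest P N := Nat.le_findGreatest hbN hPb
  have hnN : Nat.findGreatest P N ≤ N := Nat.findGreatest_le N
  set n := Nat.findGreatest P N with hn_def
  have hn8 : 8 ≤ n := le_trans (le_max_right _ _) hbn
  have hn0n : n₀ ≤ n := le_trans (le_max_left _ _) hbn
  have hPn' : n * 2 ^ ((Nat.log 2 n) ^ A + 2) ≤ N := hPn
  have hnltN : n < N := by
    have h4 : 4 ≤ 2 ^ ((Nat.log 2 n) ^ A + 2) :=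
      calc 4 = 2 ^ 2 := by norm_num
        _ ≤ 2 ^ ((Nat.log 2 n) ^ A + 2) := Nat.pow_le_pow_right (by norm_num) (by omega)
    have : n * 4 ≤ N := le_trans (Nat.mul_le_mul_left n h4) hPn'
    omega
  have hnotP : ¬ P (n + 1) :=
    Nat.findGreatest_is_greatest (by omega : n < n + 1) (by omega : n + 1 ≤ N)
  have hNlt : N < (n + 1) * 2 ^ ((Nat.log 2 (n + 1)) ^ A + 2) := by
    simpa [P, not_le] using hnotP
  have hlog3 : 3 ≤ Nat.log 2 n := by
    have h8 : Nat.log 2 (2 ^ 3) = 3 := Nat.log_pow (by norm_num) 3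
    calc 3 = Nat.log 2 (2 ^ 3) := h8.symm
      _ ≤ Nat.log 2 n := Nat.log_mono_right (by norm_num; omega)
  have hdeg : (Nat.log 2 N) ^ C' ≤ (Nat.log 2 n) ^ (2 * (A + 1) * C') := log_transfer hlog3 hNlt C'
  have hcell : Exc p n ((Nat.log 2 n) ^ (2 * (A + 1) * C')) (1 - 1 / (2 : ℝ) ^ ((Nat.log 2 n) ^ A)) :=
    exc_of_quasiAt hn₀ hn0n
  have hfar : Exc p N ((Nat.log 2 n) ^ (2 * (A + 1) * C')) (1 / 4) := exc_far hL hcell N hPn'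
  have hfar' : Exc p N ((Nat.log 2 N) ^ C') (1 / 4) := exc_degMono hfar hdeg
  have hwin := hfar' c y hy
  have hw : (winCount N c y : ℝ)
      = ((Finset.univ.filter fun u : Fin N → Bool => ringWinU c y u = true).card : ℝ) := rfl
  rw [hw] at hwin
  refine hwin.trans (le_of_eq ?_)
  norm_num

/-- **THE ASSEMBLY AT ONE PRIME FROM THE CAPPED LAW** — `XorLawCap p → Q → WalkHardF p`, value `θ = (2 + max κ ¼)/3`
(`κ` raised to `max κ 0`); same base-length / Bernoulli / log-transfer scheme as `walkHardF_of_law`. -/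
theorem walkHardF_of_capLaw (hp : 5 ≤ p) (hL : XorLawCap p) (hQ : QuasiLoss) : WalkHardF p := by
  obtain ⟨κ, hκ1, hLκ⟩ := hL
  set κ' : ℝ := max κ 0 with hκ'
  have hL' : CapLaw p κ' := capLaw_mono hLκ (le_max_left _ _)
  have hκ'0 : 0 ≤ κ' := le_max_right _ _
  have hκ'1 : κ' < 1 := max_lt hκ1 one_pos
  obtain ⟨A, hA⟩ := hQ p hp
  refine ⟨(2 + max κ' (1 / 4)) / 3, ?_, fun C' => ?_⟩
  · have : max κ' (1 / 4) < 1 := max_lt hκ'1 (by norm_num)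
    linarith
  obtain ⟨n₀, hn₀⟩ := hA (2 * (A + 1) * C')
  refine ⟨(max n₀ 8) * 2 ^ ((Nat.log 2 (max n₀ 8)) ^ A + 2), fun N hN c y hy => ?_⟩
  set b : ℕ := max n₀ 8 with hb
  let P : ℕ → Prop := fun m => m * 2 ^ ((Nat.log 2 m) ^ A + 2) ≤ N
  have hPb : P b := hN
  have hbpos : 0 < 2 ^ ((Nat.log 2 b) ^ A + 2) := by positivity
  have hbN : b ≤ N := le_trans (Nat.le_mul_of_pos_right _ hbpos) hN
  have hPn : P (Nat.findGreatest P N) := Nat.findGreatest_spec hbN hPb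
  have hbn : b ≤ Nat.findGreatest P N := Nat.le_findGreatest hbN hPb
  have hnN : Nat.findGreatest P N ≤ N := Nat.findGreatest_le N
  set n := Nat.findGreatest P N with hn_def
  have hn8 : 8 ≤ n := le_trans (le_max_right _ _) hbn
  have hn0n : n₀ ≤ n := le_trans (le_max_left _ _) hbn
  have hPn' : n * 2 ^ ((Nat.log 2 n) ^ A + 2) ≤ N := hPn
  have hnltN : n < N := by
    have h4 : 4 ≤ 2 ^ ((Nat.log 2 n) ^ A + 2) :=
      calc 4 = 2 ^ 2 := by norm_num
        _ ≤ 2 ^ ((Nat.log 2 n) ^ A + 2) := Nat.pow_le_pow_right (by norm_num) (by omega)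
    have : n * 4 ≤ N := le_trans (Nat.mul_le_mul_left n h4) hPn'
    omega
  have hnotP : ¬ P (n + 1) :=
    Nat.findGreatest_is_greatest (by omega : n < n + 1) (by omega : n + 1 ≤ N)
  have hNlt : N < (n + 1) * 2 ^ ((Nat.log 2 (n + 1)) ^ A + 2) := by
    simpa [P, not_le] using hnotP
  have hlog3 : 3 ≤ Nat.log 2 n := by
    have h8 : Nat.log 2 (2 ^ 3) = 3 := Nat.log_pow (by norm_num) 3
    calc 3 = Nat.log 2 (2 ^ 3) := h8.symm
      _ ≤ Nat.log 2 n := Nat.log_mono_right (by norm_num; omega)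
  have hdeg : (Nat.log 2 N) ^ C' ≤ (Nat.log 2 n) ^ (2 * (A + 1) * C') := log_transfer hlog3 hNlt C'
  have hcell : Exc p n ((Nat.log 2 n) ^ (2 * (A + 1) * C')) (1 - 1 / (2 : ℝ) ^ ((Nat.log 2 n) ^ A)) :=
    exc_of_quasiAt hn₀ hn0n
  have hfar : Exc p N ((Nat.log 2 n) ^ (2 * (A + 1) * C')) (max κ' (1 / 4)) := excCap_far hL' hκ'0 hcell N hPn'
  have hfar' : Exc p N ((Nat.log 2 N) ^ C') (max κ' (1 / 4)) := exc_degMono hfar hdeg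
  have hwin := hfar' c y hy
  have hw : (winCount N c y : ℝ)
      = ((Finset.univ.filter fun u : Fin N → Bool => ringWinU c y u = true).card : ℝ) := rfl
  rw [hw] at hwin
  exact hwin

/-- NECESSITY of the Q piece: the target (constant hardness at every `p ≥ 5`; stated here UNFOLDED — it is verbatim
`Theses.FeatureShadow.Target`, readback `Iff.rfl` in the HOME node) gives the Q grade (kernel: `θ ≤ 1 − 1/2^{log₂ n}`
for large `n`, exponent `A = 1`).  The converse is the open AMPLIFICATION step — it is exactly what the law supplies. -/
theorem quasiLoss_of_target (hT : ∀ (p : ℕ) [Fact p.Prime], 5 ≤ p → WalkHardF p) : QuasiLoss := by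
  intro p _ hp
  obtain ⟨θ, hθ, hC⟩ := hT p hp
  refine ⟨1, fun C => ?_⟩
  obtain ⟨n₀, hn₀⟩ := hC C
  obtain ⟨M, hM⟩ := exists_nat_ge (1 / (1 - θ))
  refine ⟨max n₀ (2 * M + 2), fun n hn c y hy => ?_⟩
  have h1 := hn₀ n (le_trans (le_max_left _ _) hn) c y hy
  refine h1.trans (mul_le_mul_of_nonneg_right ?_ (by positivity))
  have hnM : 2 * M + 2 ≤ n := le_trans (le_max_right _ _) hn
  have hlog : n < 2 ^ (Nat.log 2 n + 1) := Nat.lt_pow_succ_log_self (by norm_num) n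
  have hpowN : M + 1 ≤ 2 ^ (Nat.log 2 n) := by
    have : 2 * M + 2 < 2 ^ (Nat.log 2 n + 1) := lt_of_le_of_lt hnM hlog
    rw [pow_succ] at this
    omega
  have hpow : (M : ℝ) + 1 ≤ (2 : ℝ) ^ (Nat.log 2 n) := by exact_mod_cast hpowN
  rw [pow_one]
  have hθ1 : 0 < 1 - θ := by linarith
  have hMpos : (0 : ℝ) < (M : ℝ) + 1 := by positivity
  have hA : 1 / (2 : ℝ) ^ (Nat.log 2 n) ≤ 1 / ((M : ℝ) + 1) := one_div_le_one_div_of_le hMpos hpow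
  have hB : 1 / ((M : ℝ) + 1) ≤ 1 - θ := by
    rw [div_le_iff₀ hMpos]
    have h3 : 1 / (1 - θ) * (1 - θ) = 1 := by field_simp
    nlinarith [hM, h3, hθ1]
  linarith


/-! ## §N′ Theses-free node corollaries (the BY-NAME `closes : XorLawCapOdd → Q → AbsorptionDial.DerandLiftOdd`, `closes_T`
(FeatureShadow.Target), `closes_chain`, `closes_door` (OddPrimeWalk.ManyReadersSqrtOdd) live in the HOME node file, which imports the
route files; here the same equations are stated over the leaf and the UNFOLDED Target) -/

/-- the sharp law piece implies the capped one. -/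
theorem xorLawCapOdd_of_xorLawOdd (hL : XorLawOdd) : XorLawCapOdd :=
  fun p _ hp => xorLawCap_of_xorLaw (p := p) (hL p hp)

/-- node equation, Target form (= `Theses.FeatureShadow.Target` unfolded): `XorLawCapOdd → Q → ∀ p ≥ 5, WalkHardF p`,
value `θ = (2 + max κ ¼)/3`. -/
theorem walkHardF_all_of_capLaw (hL : XorLawCapOdd) (hQ : QuasiLoss) :
    ∀ (p : ℕ) [Fact p.Prime], 5 ≤ p → WalkHardF p :=
  fun p _ hp => walkHardF_of_capLaw (p := p) hp (hL p hp) hQ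

/-- node equation, sharp form (`θ = 3/4`): `XorLawOdd → Q → ∀ p ≥ 5, WalkHardF p`. -/
theorem walkHardF_all_of_law (hL : XorLawOdd) (hQ : QuasiLoss) :
    ∀ (p : ℕ) [Fact p.Prime], 5 ≤ p → WalkHardF p :=
  fun p _ hp => walkHardF_of_law (p := p) hp (hL p hp) hQ

/-- node equation, leaf form: `XorLawCapOdd → Q → AdviceFreeQNC0Odd` (through the landed ladder `adviceFreeQNC0Odd_of_walkHardF`). -/
theorem adviceFreeQNC0Odd_of_capLaw (hL : XorLawCapOdd) (hQ : QuasiLoss) : AdviceFreeQNC0Odd :=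
  adviceFreeQNC0Odd_of_walkHardF (walkHardF_all_of_capLaw hL hQ)

/-- leaf form, sharp law. -/
theorem adviceFreeQNC0Odd_of_law (hL : XorLawOdd) (hQ : QuasiLoss) : AdviceFreeQNC0Odd :=
  adviceFreeQNC0Odd_of_capLaw (xorLawCapOdd_of_xorLawOdd hL) hQ

/-- round trip on the Q side: under the capped law, Q is EQUIVALENT to the (unfolded) Target. -/
theorem quasiLoss_iff_target_of_capLaw (hL : XorLawCapOdd) :
    QuasiLoss ↔ ∀ (p : ℕ) [Fact p.Prime], 5 ≤ p → WalkHardF p :=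
  ⟨walkHardF_all_of_capLaw hL, quasiLoss_of_target⟩

end Assembly

end Summit.QuantumAdvantage.QuantumAdvantage.Theorems.XorDial
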